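import Literature.NumberTheory.ComplexMultiplication.FaltingsTateOfCMTwists
import Summits.HodgeConjecture.HodgeConjecture.Theorems.HCCMUnconditionalShimuraThm18_6Holds
import HarnessLib

/-!
# T5 (O-N8) — [Fal83 §5 Kor. 1] for the TWISTS (all `k`-forms) of a CM structure of primitive type / of a CM
# elliptic curve, UNCONDITIONALLY

Cell hodgecm-mathlib, fan A, binder hLiu418 (item stmt-HodgeConjecture-24832), sub-skeleton
`Cruxes/HLiu418/Lines/faltings_isogeny.lean` (row VI-1 = the floor binder
`hFal : ∀ {K} [Field K] (A B : AbelianVariety K) ℓ [Fact ℓ.Prime], faltings_tate_bijective A B ℓ`; T5 distance ledger,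
item (O-N8) «twist family», A-plan1 g8).  The Literature heads of
`Literature.NumberTheory.ComplexMultiplication.FaltingsTateOfCMTwists` prove, granted the named fact
`shimura1998_thm18_6` ([Shimura 1998, Thm. 18.6]), that for a structure `(A₀, ι₀)` of a PRIMITIVE CM type `(K, Φ)`
(any `g`; in particular every CM elliptic structure) over a number field `k ⊆ ℂ` and ANY abelian variety `A′` over `k`
GEOMETRICALLY isogenous to `A₀` (`A₀ ⊗_k ℂ ∼ A′ ⊗_k ℂ`: every `k`-form / twist of `A₀`, elliptic curves with CM by an
order of `K` geometrically isogenous to `A₀`, …), the Tate map `ℤ_ℓ ⊗ Hom_k(·,·) → Hom_{Γ_k}(T_ℓ ·, T_ℓ ·)` is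
bijective for `(A₀, A′)`, `(A′, A₀)`, `(A′, A′)` — in particular for two structures of the SAME type over `k`,
whether `k`-isogenous or not.  That fact is a THEOREM of the tree Summits-side (`Theorems.shimura1998_thm18_6_holds`,
row II-1), so here the VI-1 TEXT ITSELF is decided with NO hypothesis on this family — the one CM-elliptic pair
family not reached by ★ `HLiu418FaltingsTateOfCMEllipticPowers` / ★ `…OfDistinctCMFields` (same field, same
type, non-`k`-isogenous twists).  Witness rung («distance ledger»); no floor change, books 0.

HC_CM is proved only modulo the printed citations of the floor until rung 0 closes; this file moves no floor binder.
-/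

-- mandated namespace `Summit.HodgeConjecture.HodgeConjecture.Theorems` trips `linter.dupNamespace` (single-problem
-- summit); off as in `HCCMUnconditionalShimuraThm18_6Holds.lean`.
set_option linter.dupNamespace false

open CategoryTheory NumberField
open scoped NumberField

namespace Summit.HodgeConjecture.HodgeConjecture.Theorems

open Literature.AlgebraicGeometry.Motives
open Literature.NumberTheory.ComplexMultiplication

/-- **[Faltings 1983, §5 Kor. 1] for every `k`-form of a variety geometrically isogenous to a structure of
PRIMITIVE CM type, every dimension, unconditionally**: for `(A₀, ι₀)` of CM type `(K, Φ)` over a number field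
`k ⊆ ℂ` with `Φ` primitive, every abelian variety `A′` over `k` with `A₀ ⊗_k ℂ ∼ A′ ⊗_k ℂ` and every prime `ℓ`,
`faltings_tate_bijective` holds for `(A₀, A′)`, `(A′, A₀)` and `(A′, A′)` — the Literature head fed with the
tree's theorem `shimura1998_thm18_6_holds`. [cite: Faltings1983Endlichkeit, §5 Korollar 1 and proof of Satz 4 (p. 360)]
[cite: Shimura1998, §13.2 Theorem 2, §18.6 Theorem 18.6 and §7.4 Proposition 15] -/
theorem faltings_tate_bijective_of_isIsogenous_complex_of_primitive_CM
    {k : Type} [Field k] [NumberField k] [Algebra k ℂ] {K : Type} [Field K] [NumberField K] [IsCMField K]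
    (Φ : CMType K) (A₀ : AbelianVariety k) (ι₀ : 𝓞 K →+* End A₀) (hA : IsCMTypeRealisationOver Φ A₀ ι₀)
    {φ₀ : K →+* ℂ} (hprim : IsPrimitive (ℂ ≃+* ℂ) Φ.1 φ₀) (A' : AbelianVariety k)
    (hiso : AbelianVariety.IsIsogenous (A₀.baseChange ℂ) (A'.baseChange ℂ)) (ℓ : ℕ) [Fact ℓ.Prime] :
    faltings_tate_bijective A₀ A' ℓ ∧ faltings_tate_bijective A' A₀ ℓ ∧ faltings_tate_bijective A' A' ℓ :=
  faltings_tate_bijective_of_isIsogenous_complex_of_isPrimitive_of_thm18_6 shimura1998_thm18_6_holds Φ A₀ ι₀ hA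
    hprim A' hiso ℓ

/-- **[Faltings 1983, §5 Kor. 1] for every `k`-form of a variety geometrically isogenous to a CM ELLIPTIC structure,
unconditionally** (`[K : ℚ] = 2`): all twists of a CM elliptic curve over `k`, and the elliptic curves over `k` with
CM by an order of `K` geometrically isogenous to it. [cite: Faltings1983Endlichkeit, §5 Korollar 1 and proof of Satz 4 (p. 360)]
[cite: Shimura1998, §18.6 Theorem 18.6 and §7.4 Proposition 15] -/
theorem faltings_tate_bijective_of_isIsogenous_complex_of_CM_elliptic
    {k : Type} [Field k] [NumberField k] [Algebra k ℂ] {K : Type} [Field K] [NumberField K] [IsCMField K]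
    (Φ : CMType K) (A₀ : AbelianVariety k) (ι₀ : 𝓞 K →+* End A₀) (hA : IsCMTypeRealisationOver Φ A₀ ι₀)
    (h2 : Module.finrank ℚ K = 2) (A' : AbelianVariety k)
    (hiso : AbelianVariety.IsIsogenous (A₀.baseChange ℂ) (A'.baseChange ℂ)) (ℓ : ℕ) [Fact ℓ.Prime] :
    faltings_tate_bijective A₀ A' ℓ ∧ faltings_tate_bijective A' A₀ ℓ ∧ faltings_tate_bijective A' A' ℓ :=
  faltings_tate_bijective_of_isIsogenous_complex_of_CM_elliptic_of_thm18_6 shimura1998_thm18_6_holds Φ A₀ ι₀ hA h2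
    A' hiso ℓ

/-- **[Faltings 1983, §5 Kor. 1] FOR TWO STRUCTURES OF ONE PRIMITIVE CM TYPE, every dimension, UNCONDITIONALLY**:
for `(A, ι)`, `(A′, ι′)` of the same primitive type `(K, Φ)` over a number field `k ⊆ ℂ` and every prime `ℓ`,
`faltings_tate_bijective A A′ ℓ` — no Hecke character, no uniformisation, no `k`-isogeny hypothesis.
[cite: Faltings1983Endlichkeit, §5 Korollar 1] [cite: Shimura1998, §7.4 Proposition 15 and §18.6 Theorem 18.6] -/
theorem faltings_tate_bijective_of_sameType_of_primitive_CM
    {k : Type} [Field k] [Algebra k ℂ] {K : Type} [Field K] [NumberField K] [IsCMField K]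
    (Φ : CMType K) (A A' : AbelianVariety k) (ι : 𝓞 K →+* End A) (ι' : 𝓞 K →+* End A')
    (hA : IsCMTypeRealisationOver Φ A ι) (hA' : IsCMTypeRealisationOver Φ A' ι')
    {φ₀ : K →+* ℂ} (hprim : IsPrimitive (ℂ ≃+* ℂ) Φ.1 φ₀) (ℓ : ℕ) [Fact ℓ.Prime] :
    faltings_tate_bijective A A' ℓ :=
  faltings_tate_bijective_of_sameType_of_isPrimitive_of_thm18_6 shimura1998_thm18_6_holds Φ A A' ι ι' hA hA' hprim ℓ

/-- **[Faltings 1983, §5 Kor. 1] FOR TWO CM-ELLIPTIC STRUCTURES OF ONE TYPE, UNCONDITIONALLY** (`[K : ℚ] = 2`):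
for `(A, ι)`, `(A′, ι′)` of type `(K, Φ)` over a number field `k ⊆ ℂ` — a CM elliptic curve and any twist carrying
the `𝓞_K`-action over `k` — and every prime `ℓ`, `faltings_tate_bijective A A′ ℓ` (the VI-1 TEXT on the twist
family, no hypothesis). [cite: Faltings1983Endlichkeit, §5 Korollar 1] [cite: Shimura1998, §7.4 Proposition 15 and §18.6 Theorem 18.6] -/
theorem faltings_tate_bijective_of_sameType_of_CM_elliptic
    {k : Type} [Field k] [Algebra k ℂ] {K : Type} [Field K] [NumberField K] [IsCMField K]
    (Φ : CMType K) (A A' : AbelianVariety k) (ι : 𝓞 K →+* End A) (ι' : 𝓞 K →+* End A')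
    (hA : IsCMTypeRealisationOver Φ A ι) (hA' : IsCMTypeRealisationOver Φ A' ι') (h2 : Module.finrank ℚ K = 2)
    (ℓ : ℕ) [Fact ℓ.Prime] : faltings_tate_bijective A A' ℓ :=
  faltings_tate_bijective_of_sameType_of_CM_elliptic_of_thm18_6 shimura1998_thm18_6_holds Φ A A' ι ι' hA hA' h2 ℓ

end Summit.HodgeConjecture.HodgeConjecture.Theorems
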